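import Summits.Ventures.HSemireg.FormulaNStatement

/-!
# Venture HSemireg — FORMULA-N, the UNIFORM-IN-n STATEMENT (1/3): the polynomial `P_n`, the box rank `R_k(n) = [t^k]P_n(t)²`
# in closed form for all `n`, and the identified n-table columns as closed forms in `n` with the signed rows `n = 1..5`

HONEST FRAMING. Part of the Lean index of the computation cell `pub-hsemireg` (seat p10, Sunday typer «UNIFORM-IN-n»).
ARITHMETIC ONLY: no variety, no cohomology theory, no sheaf, no semiregularity map is constructed here; nothing here says that
HC / HC_CM / HC_AV holds; no Literature fact is declared or used.  This file TYPES, uniformly in `n`, the integer columns the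
cell's signed structure file speaks about and proves what is arithmetic; every geometric identification (the DICTIONARY: which
cohomology group / Ext group / rank each column is) is QUOTED from the files of record in the docstrings, with its tier, and is
NOT asserted in Lean.  Companions: `FormulaNUniformLaw.lean` (2/3: the K-ISOTYPIC SATURATION LAW (S1)–(S5) as a named skeleton —
abstract saturation, parity arithmetic, the conjecture's n-pattern) and `FormulaNUniformKernel.lean` (3/3: the class side
instantiated on th-7's wedge model, all `n`, with the `n = 2, 3, 4` instances as kernel theorems).

SOURCES OF RECORD (hash-pinned).  general-structure/STRUCTURE.md v1.0-FINAL sha256/16 `9059cdf4f7e18671` (co-signed lead g5,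
th-6 21/21, th-7 8/8, ref-4, ref g30, red-3; signatures folded as v1.0-SIGNED `9b196a05977dd067`), §1.1 «column table» C1–C15,
§1.0 D8/D9 and §2 «(S) THE K-ISOTYPIC SATURATION LAW»; target-g6/VERDICT-G6.md v1.0 SIGNED `1651dcc7322662a2` § FORMULA-N /
STRUCTURE; theory/FORMULA-N.md PART A v1.8.39 (th-6; PART A text `504183573ee485a7`) §0 (T)(K)(E)(S), §2.3, §6 and PART B
theory/FORMULA-N-th7.md v1.7zz19 `98279af8efffc8e5` (th-7) §A–§D (Σ1–Σ6), §F (n-table).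

WHAT IS HERE (namespace `Summit.Ventures.HSemireg.FormulaN.Uniform`; th-6's `FormulaN.transversePairRank n k = r_k(n)` reused).
* §1 `P n = 2(1+X)^n − 1 − X^n ∈ ℤ[X]`; `coeff_P : [t^k]P_n = r_k(n) = 2C(n,k) − [k=0] − [k=n]` (FORMULA-N §0 (T)); `boxRank n k :=
  Σ_{i+j=k} r_i(n)·r_j(n)` — the DEFINITION of `R_k(n)` as the Künneth / Cauchy product (§0 (K)); `coeff_P_sq : [t^k]P_n(t)² =
  boxRank n k`; `boxRank_closed` — the CLOSED FORM `R_k(n) + 4C(n,k) + 4[n ≤ k]C(n,k−n) = 4C(2n,k) + [k=0] + 2[k=n] + [k=2n]` for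
  ALL `n, k`, literally the right-hand shape of the tree's kernel theorem `WedgeBox.finrank_range_wedgeMap_fac_mul_all` (th-7),
  so that theorem reads «`rank(θ ↦ θ ∧ (f₁ ∧ f₂) ∣ ⋀^k K^{4n}) = [t^k]P_n(t)²`» (done in 3/3).
* §2 low-degree closed forms, all `n`: `boxRank n 0 = 1` (`n ≥ 1`), `boxRank n 1 = 4n` (`n ≥ 2`), `boxRank n 2 + 2n = 6n²`
  (`n ≥ 3`), `boxRank n 3 + 4C(n,3) = 4C(2n,3)` (`n ≥ 4`); `dimHT n k := C(4n,k)`, `dimHT n 2 + 2n = 8n²`; `boxRank_le_dimHT`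
  (so `kerDim n k := dimHT n k − boxRank n k` never truncates); `kerDim n 2 = 2n²` (`n ≥ 3`).  ONE formula, no fitted
  correction: the rows `(6,1,5)`, `(28,18,10)` at `n = 1, 2` differ from `(8n²−2n, 6n²−2n, 2n²)` only because there `k = 2 ≥ n`
  (FORMULA-N §0 (K); STRUCTURE C2/C4 «(d) = derived exception»).
* §3 the other IDENTIFIED columns of STRUCTURE §1.1 as closed forms in `n` — `dolbeaultTargetDim` (C1″), `weilLocusDim` /
  `weilTangentDim` (C5), `markmanWindow` (C6, `= (r₀, r₁, r₂)`), `plainFamilyARank` / `plainFamilyAKer` (C10), `sigmaBlockRank`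
  (C13), `weilConeRank` (C15/D9 THEOREM R, `= boxRank` at `ρ = 2`) — and `nTable_*`: the `n = 1..5` rows of the signed table and
  the profiles `P_n`, `P_n²` at `n = 2, 3, 4`, certified by `decide`.  Only arithmetic is asserted; C7/C9/C11/C12/C14's words,
  C16–C19 and every tier live in STRUCTURE.md.
WHAT IS ELSEWHERE IN THE TREE (kernel, all `n`): THEOREM T `WedgePair.finrank_range_wedgeMap_pointPair` / `FormulaN.fn4_classLevel`;
THEOREM K_lin `Wedge.Kunneth.finrank_range_wedge_mul`; THEOREM H `Wedge.Hankel.hankelLaw`; the BOX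
`WedgeBox.finrank_range_wedgeMap_fac_mul_all`; THEOREM R `Wedge.Weil.weilRank_nn`; THEOREM S `FormulaN.Squeeze.theoremS`; on real
carriers `contractionRank_pointPairBox` (`6n² − 2n`, `n ≥ 3`) / `contractionRank_pointPairBox_two` (`18`).
-/

open Polynomial Finset Module

namespace Summit.Ventures.HSemireg.FormulaN.Uniform

/-! ## §1. `P_n`, `r_k(n)`, `R_k(n) = [t^k] P_n(t)²` and the closed form -/

/-- `P_n(t) := 2(1+t)^n − 1 − t^n` (FORMULA-N §0; STRUCTURE D8): the rank / Ext polynomial of an N-transversal 2-secant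
factor (`1 + 4t + t²`, `1 + 6t + 6t² + t³`, `1 + 8t + 12t² + 8t³ + t⁴`, … for `n = 2, 3, 4, …`). -/
noncomputable def P (n : ℕ) : ℤ[X] := 2 * (1 + X) ^ n - 1 - X ^ n

/-- th-6's `r_k(n) = 2C(n,k) − [k=0] − [k=n]` never truncates: the same identity holds over `ℤ`. -/
theorem transversePairRank_cast (n k : ℕ) :
    (transversePairRank n k : ℤ) = 2 * (n.choose k : ℤ) - (if k = 0 then 1 else 0) - (if k = n then 1 else 0) := by
  unfold transversePairRank
  have hpos : k ≤ n → 1 ≤ n.choose k := fun h => Nat.choose_pos h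
  by_cases h0 : k = 0
  · by_cases hn : k = n
    · subst h0; subst hn; simp
    · subst h0
      have : 1 ≤ n.choose 0 := hpos (Nat.zero_le n)
      simp only [hn, if_true, if_false]; omega
  · by_cases hn : k = n
    · subst hn
      have : 1 ≤ k.choose k := hpos le_rfl
      simp only [h0, if_true, if_false]; omega
    · simp only [h0, hn, if_false]; omega

/-- `[t^k] P_n(t) = r_k(n)` (FORMULA-N §0 (T): `1, 2C(n,1), …, 2C(n,n−1), 1`). -/
theorem coeff_P (n k : ℕ) : (P n).coeff k = (transversePairRank n k : ℤ) := by
  rw [transversePairRank_cast, P, coeff_sub, coeff_sub, coeff_ofNat_mul, add_comm (1 : ℤ[X]), coeff_X_add_one_pow,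
    coeff_one, coeff_X_pow]

/-- `R_k(n)`, DEFINED as the Künneth / Cauchy product `Σ_{i+j=k} r_i(n)·r_j(n)` (FORMULA-N §0 (K), §2.3: the `HT^k`-rank of
`⌟ch(F₁ ⊠ F₂)` on `Y = X × X′` is `[t^k] P_X(t)·P_{X′}(t)`; STRUCTURE (S1) «`R₂(n) = [t²](2(1+t)ⁿ − 1 − tⁿ)²`»). -/
def boxRank (n k : ℕ) : ℕ :=
  ∑ ij ∈ antidiagonal k, transversePairRank n ij.1 * transversePairRank n ij.2

/-- `[t^k] P_n(t)² = R_k(n)`. -/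
theorem coeff_P_sq (n k : ℕ) : (P n ^ 2).coeff k = (boxRank n k : ℤ) := by
  rw [sq, coeff_mul, boxRank]
  push_cast
  refine Finset.sum_congr rfl fun ij _ => ?_
  rw [coeff_P, coeff_P]

/-- `P_n² = 4(1+t)^{2n} − 4(1+t)^n − 4(1+t)^n t^n + 1 + 2t^n + t^{2n}`. -/
theorem P_sq_eq (n : ℕ) : P n ^ 2 = 4 * (1 + X) ^ (n + n) - 4 * (1 + X) ^ n - 4 * ((1 + X) ^ n * X ^ n)
    + 1 + 2 * X ^ n + X ^ n * X ^ n := by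
  rw [P]; ring

/-- CLOSED FORM over `ℤ`: `R_k(n) = 4C(2n,k) − 4C(n,k) − 4[n ≤ k]C(n,k−n) + [k=0] + 2[k=n] + [k=2n]` (FORMULA-N §0 (K)). -/
theorem boxRank_cast (n k : ℕ) : (boxRank n k : ℤ) = 4 * ((n + n).choose k : ℤ) - 4 * (n.choose k : ℤ)
    - 4 * (if n ≤ k then (n.choose (k - n) : ℤ) else 0) + (if k = 0 then 1 else 0) + (if k = n then 2 else 0)
    + (if k = n + n then 1 else 0) := by
  rw [← coeff_P_sq, P_sq_eq]
  simp only [coeff_add, coeff_sub]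
  rw [coeff_ofNat_mul, coeff_ofNat_mul, coeff_ofNat_mul, coeff_ofNat_mul, add_comm (1 : ℤ[X]),
    coeff_X_add_one_pow, coeff_X_add_one_pow, coeff_mul_X_pow', coeff_X_add_one_pow, coeff_one, coeff_X_pow,
    ← pow_add, coeff_X_pow]
  simp only [eq_comm (a := k)]
  split_ifs <;> ring

/-- CLOSED FORM, additive over `ℕ`, ALL `n, k` — exactly the right-hand shape of the tree's kernel theorem
`WedgeBox.finrank_range_wedgeMap_fac_mul_all`, so that one reads «`rank(θ ↦ θ ∧ (f₁ ∧ f₂) ∣ ⋀^k K^{4n}) = [t^k]P_n(t)²`». -/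
theorem boxRank_closed (n k : ℕ) :
    boxRank n k + 4 * n.choose k + 4 * (if n ≤ k then n.choose (k - n) else 0) =
      4 * (n + n).choose k + (if k = 0 then 1 else 0) + (if k = n then 2 else 0) + (if k = n + n then 1 else 0) := by
  have h := boxRank_cast n k
  split_ifs at h ⊢ <;> push_cast at h ⊢ <;> omega

/-! ## §2. Low-degree closed forms (all `n`), `dim HT^k = C(4n,k)`, and the kernel column -/

/-- `R₀(n) = 1` for `n ≥ 1` (`P_0 = 0`, so `R₀(0) = 0`). -/
theorem boxRank_zero {n : ℕ} (hn : 0 < n) : boxRank n 0 = 1 := by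
  have h := boxRank_closed n 0
  simp only [if_true, Nat.choose_zero_right, show ¬ n ≤ 0 by omega, if_false, show (0 : ℕ) ≠ n by omega,
    show (0 : ℕ) ≠ n + n by omega] at h
  omega

/-- `R₁(n) = 4n` for `n ≥ 2` (STRUCTURE: `rank σ∣Ext¹ = 4n`; FORMULA-N §0 (S)). -/
theorem boxRank_one {n : ℕ} (hn : 2 ≤ n) : boxRank n 1 = 4 * n := by
  have h := boxRank_closed n 1
  simp only [show (1 : ℕ) ≠ 0 by omega, show ¬ n ≤ 1 by omega, show (1 : ℕ) ≠ n by omega,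
    show (1 : ℕ) ≠ n + n by omega, if_false, Nat.choose_one_right] at h
  omega

/-- C2/C3 (STRUCTURE §1.1; (S1) third number): `R₂(n) + 2n = 6n²` for `n ≥ 3`, i.e. `R₂(n) = 6n² − 2n`. -/
theorem boxRank_two {n : ℕ} (hn : 3 ≤ n) : boxRank n 2 + 2 * n = 6 * n ^ 2 := by
  have h := boxRank_cast n 2
  simp only [show (2 : ℕ) ≠ 0 by omega, show ¬ n ≤ 2 by omega, show (2 : ℕ) ≠ n by omega,
    show (2 : ℕ) ≠ n + n by omega, if_false, mul_zero, sub_zero, add_zero] at h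
  have hq : ((boxRank n 2 : ℕ) : ℚ) = 4 * (((n + n).choose 2 : ℕ) : ℚ) - 4 * ((n.choose 2 : ℕ) : ℚ) := by
    exact_mod_cast h
  rw [Nat.cast_choose_two, Nat.cast_choose_two] at hq
  push_cast at hq
  have key : ((boxRank n 2 + 2 * n : ℕ) : ℚ) = ((6 * n ^ 2 : ℕ) : ℚ) := by
    push_cast
    rw [hq]
    ring
  exact_mod_cast key

/-- C14 (STRUCTURE §1.1): `R₃(n) + 4C(n,3) = 4C(2n,3)` for `n ≥ 4` (`208, 440, 800, 1316, 2016` at `n = 4..8`); at `n = 3` the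
degree-`n` terms give `74`, see `nTable_boxRank_three`. -/
theorem boxRank_three {n : ℕ} (hn : 4 ≤ n) : boxRank n 3 + 4 * n.choose 3 = 4 * (n + n).choose 3 := by
  have h := boxRank_closed n 3
  simp only [show (3 : ℕ) ≠ 0 by omega, show ¬ n ≤ 3 by omega, show (3 : ℕ) ≠ n by omega,
    show (3 : ℕ) ≠ n + n by omega, if_false] at h
  omega

/-- C1 (STRUCTURE §1.1; (S1) first number): `dim HT^k(Y) = C(4n, k)` for an abelian `2n`-fold `Y` (HKR: `HT^k = ⋀^k U`,
`dim U = 4n`) — here simply the NAME of the binomial coefficient, written `n+n+n+n` as in `WedgeBox.I n = Fin (n+n+n+n)`. -/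
def dimHT (n k : ℕ) : ℕ := (n + n + n + n).choose k

/-- `C(4n,2) + 2n = 8n²`, i.e. `dim HT²(Y) = 8n² − 2n = b₂(Y)` (C1). -/
theorem dimHT_two (n : ℕ) : dimHT n 2 + 2 * n = 8 * n ^ 2 := by
  have key : ((dimHT n 2 + 2 * n : ℕ) : ℚ) = ((8 * n ^ 2 : ℕ) : ℚ) := by
    unfold dimHT
    push_cast
    rw [Nat.cast_choose_two]
    push_cast
    ring
  exact_mod_cast key

/-- `r_k(n) ≤ C(2n, k)` (two of the Vandermonde terms already give `2C(n,k)` when `k ≠ 0`). -/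
theorem transversePairRank_le (n k : ℕ) : transversePairRank n k ≤ (n + n).choose k := by
  unfold transversePairRank
  rcases Nat.eq_zero_or_pos k with rfl | hk
  · simp
  · have hV := Nat.add_choose_eq n n k
    have hsub : ({((k, 0) : ℕ × ℕ), (0, k)} : Finset (ℕ × ℕ)) ⊆ antidiagonal k := by
      intro x hx
      simp only [Finset.mem_insert, Finset.mem_singleton] at hx
      rcases hx with rfl | rfl <;> simp
    have h2 := Finset.sum_le_sum_of_subset (f := fun ij : ℕ × ℕ => n.choose ij.1 * n.choose ij.2) hsub
    rw [Finset.sum_pair (by simp; omega), ← hV] at h2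
    simp only [Nat.choose_zero_right, mul_one, one_mul] at h2
    omega

/-- `R_k(n) ≤ C(4n, k)`: the rank column never exceeds the dimension column (arithmetic form; on the wedge model this is
`rank ≤ dim` of `θ ↦ θ ∧ box` on `⋀^k K^{4n}`). -/
theorem boxRank_le_dimHT (n k : ℕ) : boxRank n k ≤ dimHT n k := by
  unfold boxRank dimHT
  rw [show n + n + n + n = (n + n) + (n + n) by omega, Nat.add_choose_eq]
  exact Finset.sum_le_sum fun ij _ => Nat.mul_le_mul (transversePairRank_le n ij.1) (transversePairRank_le n ij.2)

/-- C4 (STRUCTURE §1.1; (S1) fourth number): `dim ker ⌟ch(E) on HT^k = C(4n,k) − R_k(n)` — a genuine difference by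
`boxRank_le_dimHT`. -/
def kerDim (n k : ℕ) : ℕ := dimHT n k - boxRank n k

/-- `kerDim + boxRank = dimHT` (no truncation). -/
theorem kerDim_add_boxRank (n k : ℕ) : kerDim n k + boxRank n k = dimHT n k :=
  Nat.sub_add_cancel (boxRank_le_dimHT n k)

/-- C4: `dim ker ⌟ch(E) ∣ HT² = 2n²` UNIFORMLY for `n ≥ 3` (STRUCTURE (S1): «the weight-0 piece; as a subspace the transported
split-deformation piece `H¹(T_X) ⊕ H¹(T_{X′})` of the source box»; named coincidence corrections `10 = 8 + 2`, `5` at `n ≤ 2`). -/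
theorem kerDim_two {n : ℕ} (hn : 3 ≤ n) : kerDim n 2 = 2 * n ^ 2 := by
  have h1 := kerDim_add_boxRank n 2
  have h2 := boxRank_two hn
  have h3 := dimHT_two n
  omega

/-! ## §3. The other identified columns (closed forms in `n`) and the signed n-table, `n = 1..5` -/

/-- C1″: `dim ⊕_p H^{p+2}(Y, Ω^p) = C(4n, 2n−2)`, the Dolbeault TARGET of `σ` (equal to `dim HT²` at `n = 2` only — the
«n = 2 trap», red-7 §1). Bookkeeping name. -/
def dolbeaultTargetDim (n : ℕ) : ℕ := (n + n + n + n).choose (n + n - 2)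

/-- C5 (first number): `dim ker(⌟W_K) ∩ H¹(T_Y) = 2n²`, the K-weight-0 part of `V̄^∨ ⊗ V` (STRUCTURE D3; engine ×3 `n ≤ 6`). -/
def weilLocusDim (n : ℕ) : ℕ := 2 * n ^ 2

/-- C5 (second number): `T_W = dim SU(n,n)/S(U(n)×U(n)) = n²`, the tangent space of the Weil-type component (STRUCTURE D3). -/
def weilTangentDim (n : ℕ) : ℕ := n ^ 2

/-- C6: Markman's sufficient window `(e₀, e₁, e₂)^G ≤ (1, 2n, n(n−1))` = `(r₀, r₁, r₂)(n)` ([Mar25] Lemma 8.3.4 as read by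
the cell; STRUCTURE C6 / th-7 Σ5). -/
def markmanWindow (n : ℕ) : ℕ × ℕ × ℕ := (1, 2 * n, n * (n - 1))

/-- C6 is the head of `P_n`: `(r₀(n), r₁(n), r₂(n)) = (1, 2n, n(n−1))` for `n ≥ 3`. -/
theorem markmanWindow_eq {n : ℕ} (hn : 3 ≤ n) :
    markmanWindow n = (transversePairRank n 0, transversePairRank n 1, transversePairRank n 2) := by
  unfold markmanWindow transversePairRank
  simp only [if_true, show (0 : ℕ) ≠ n by omega, show (1 : ℕ) ≠ 0 by omega, show (1 : ℕ) ≠ n by omega,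
    show (2 : ℕ) ≠ 0 by omega, show (2 : ℕ) ≠ n by omega, if_false, Nat.choose_zero_right, Nat.choose_one_right,
    Nat.choose_two_right, Nat.sub_zero]
  refine Prod.ext rfl (Prod.ext rfl ?_)
  exact (Nat.two_mul_div_two_of_even (Nat.even_mul_pred_self n)).symm

/-- C10: FAMILY A PLAIN MEMBER `F_n = I_{p₁} ⊠ … ⊠ I_{pₙ}` on `(E²)ⁿ`: `HT²`-rank = `dim Ext² = [t²](1+4t+t²)ⁿ = n + 16·C(n,2)`
(one factor in `Ext²`, or two factors in `Ext¹ ⊗ Ext¹`; STRUCTURE C10, th-7 Σ3 «`8n² − 7n`», measured ×3 `n ≤ 5`, bench `n ≤ 8`). -/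
def plainFamilyARank (n : ℕ) : ℕ := n + 16 * n.choose 2

/-- C10: the kernel `5n` of the plain family-A member. -/
def plainFamilyAKer (n : ℕ) : ℕ := 5 * n

/-- `n + 16C(n,2) = 8n² − 7n` and `(8n² − 2n) − (8n² − 7n) = 5n`: C10's three numbers are consistent with C1. -/
theorem plainFamilyARank_eq (n : ℕ) :
    plainFamilyARank n + 7 * n = 8 * n ^ 2 ∧ plainFamilyARank n + plainFamilyAKer n = dimHT n 2 := by
  have h1 : plainFamilyARank n + 7 * n = 8 * n ^ 2 := by
    have key : ((plainFamilyARank n + 7 * n : ℕ) : ℚ) = ((8 * n ^ 2 : ℕ) : ℚ) := by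
      unfold plainFamilyARank
      push_cast
      rw [Nat.cast_choose_two]
      ring
    exact_mod_cast key
  have h2 := dimHT_two n
  refine ⟨h1, ?_⟩
  unfold plainFamilyAKer
  omega

/-- C13: per-`q` BLOCK RANKS of `σ` on `Ext²(G_n, G_n)` into the Dolbeault blocks `H^{q+2}(Ω^q)`: `2n² − n` at `q = 0, 2n−2`,
`2n²` at `q = n−1`, `n² − n` at `q = n−2, n`, `0` otherwise (th-7 Σ4, seat-proved on paper from (BF) + Künneth; MEASURED `(6,8,6)`
at `n = 2` (STEP-0, signed) and `(15,6,18,6,15)` at `n = 3` (engine-1, predicted before the number); FORMULA-N §7 FN-2).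
Block sub-ranks are NOT additive and NOT FM/twist-invariants (STRUCTURE D5); numbers only, no identification asserted. -/
def sigmaBlockRank (n q : ℕ) : ℕ :=
  if q = 0 ∨ q = n + n - 2 then 2 * n ^ 2 - n
  else if q = n - 1 then 2 * n ^ 2
  else if q = n - 2 ∨ q = n then n ^ 2 - n
  else 0

/-- C15/D9, THEOREM R (gs-eng-1 / th-6 COROLLARY R / th-7 R-B; tree `Wedge.Weil.weilRank_nn`): on the Weil cone `ℚ[h] ⊕ W_K` of a
`2n`-fold, a W-carrying class-exact `v` whose `ℚ[h]`-part has Hankel rank `ρ` has `HT²`-rank `(4 + ρ)n² − 2n` (`n ≥ 3`). -/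
def weilConeRank (n ρ : ℕ) : ℕ := (4 + ρ) * n ^ 2 - 2 * n

/-- THEOREM R at secant type `ρ = 2` IS the box column: `(4+2)n² − 2n = R₂(n)` (`n ≥ 3`; STRUCTURE D9 «every object of record
has ρ = 2 ⇒ 6n² − 2n = C2/C3»). -/
theorem weilConeRank_two {n : ℕ} (hn : 3 ≤ n) : weilConeRank n 2 = boxRank n 2 := by
  have h := boxRank_two hn
  unfold weilConeRank
  omega

/-- THE SIGNED n-TABLE, rows `n = 1, 2, 3, 4, 5` (STRUCTURE §1.1 C1 · C2/C3 · C4): `(dim HT², R₂, ker) =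
(6,1,5) · (28,18,10) · (66,48,18) · (120,88,32) · (190,140,50)`. -/
theorem nTable_degree_two :
    (List.range 5).map (fun i => (dimHT (i + 1) 2, boxRank (i + 1) 2, kerDim (i + 1) 2)) =
      [(6, 1, 5), (28, 18, 10), (66, 48, 18), (120, 88, 32), (190, 140, 50)] := by
  decide

/-- C14: `R₃(n) = [t³]P_n(t)² = 8 · 74 · 208 · 440` at `n = 2, 3, 4, 5` (the `n = 3` value is `74`, not `4C(6,3) − 4 = 76`:
the degree-`n` terms `−4C(n,0) + 2` of the closed form). -/
theorem nTable_boxRank_three : (List.range 4).map (fun i => boxRank (i + 2) 3) = [8, 74, 208, 440] := by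
  decide

/-- The full profiles `(R_k(n))_{k ≤ 2n} = P_n(t)²` at `n = 2, 3, 4`: `(1,8,18,8,1)`, `(1,12,48,74,48,12,1)`,
`(1,16,88,208,274,208,88,16,1)` — and the factor profiles `(r_k(n))_{k ≤ n} = P_n`: `(1,4,1)`, `(1,6,6,1)`, `(1,8,12,8,1)`
(th-7 Σ3: the Ext-Poincaré polynomials of `I_p ⊠ I_q` and `I_p`; FORMULA-N §0 (E)). -/
theorem nTable_profiles :
    (List.range 5).map (boxRank 2) = [1, 8, 18, 8, 1] ∧
    (List.range 7).map (boxRank 3) = [1, 12, 48, 74, 48, 12, 1] ∧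
    (List.range 9).map (boxRank 4) = [1, 16, 88, 208, 274, 208, 88, 16, 1] ∧
    (List.range 3).map (transversePairRank 2) = [1, 4, 1] ∧
    (List.range 4).map (transversePairRank 3) = [1, 6, 6, 1] ∧
    (List.range 5).map (transversePairRank 4) = [1, 8, 12, 8, 1] := by
  decide

/-- The remaining identified columns at `n = 1..5`: C1″ `1 · 28 · 495 · 8008 · 125970`; C5 `(2,1) · (8,4) · (18,9) · (32,16) ·
(50,25)`; C6 `(1,6,6) · (1,8,12) · (1,10,20)` at `n = 3, 4, 5`; C10 `(rank, ker) = (1,5)* · (18,10) · (51,15) · (100,20) · (165,25)`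
(`*` the `n = 1` cell of C10 is not a census row); C13 `(6,8,6) · (15,6,18,6,15) · (28,0,12,32,12,0,28) · (45,0,0,20,50,20,0,0,45)`
at `n = 2..5`. -/
theorem nTable_columns :
    (List.range 5).map (fun i => dolbeaultTargetDim (i + 1)) = [1, 28, 495, 8008, 125970] ∧
    (List.range 5).map (fun i => (weilLocusDim (i + 1), weilTangentDim (i + 1))) =
      [(2, 1), (8, 4), (18, 9), (32, 16), (50, 25)] ∧
    (List.range 3).map (fun i => markmanWindow (i + 3)) = [(1, 6, 6), (1, 8, 12), (1, 10, 20)] ∧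
    (List.range 5).map (fun i => (plainFamilyARank (i + 1), plainFamilyAKer (i + 1))) =
      [(1, 5), (18, 10), (51, 15), (100, 20), (165, 25)] ∧
    (List.range 3).map (sigmaBlockRank 2) = [6, 8, 6] ∧
    (List.range 5).map (sigmaBlockRank 3) = [15, 6, 18, 6, 15] ∧
    (List.range 7).map (sigmaBlockRank 4) = [28, 0, 12, 32, 12, 0, 28] ∧
    (List.range 9).map (sigmaBlockRank 5) = [45, 0, 0, 20, 50, 20, 0, 0, 45] := by
  decide

end Summit.Ventures.HSemireg.FormulaN.Uniform
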